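import Summits.AtomisticToContinuum.HydrodynamicLimit.Theorems.LambertianContactSwapLambertianEulerHeartsLog
import HarnessLib

/-!
# The two research inputs of the kinetic log-heart: clamped window large deviations under local-Gibbs restart (KCW-Λ) and Gaussian velocity tails along `Λ` (TL1G-Λ) (line `Sketch`, crux stmt-11854)

Support file (`--supports stmt-AtomisticToContinuum-11854`).  Lead c6 dissected the kinetic heart P3Λ into the landed step ENT
(window entropy inequality with restart, `…WindowEntropyInequality.window_entropyInequality_restart`, p136234), the landed STATICS
(`…OrthogonalCurrentsMean`, p136127) and two research inputs (`Cruxes/LambertianEuler/Lines/Sketch.md` §c6.3); lead c7 typed the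
heart in the log-shell (`…HeartsLog.KineticOneBlockInMeanLambdaLog`) that this dissection actually delivers (§c7.2, §c7.4).  This file
NAMES the two inputs so that the reduction `KCW-Λ → TL1G-Λ → KineticOneBlockInMeanLambdaLog` can be kernel-checked
(`…LambertianEulerKineticHeartOfInputs`):

* §1 the pointwise fast kinetic current `Ykin` (the integrand of the line's `Yint`, `Yint_eq` by `rfl`) and its velocity clamp
  `YkinClamp V` (`|v − u_r(x)| ≤ V`);
* §2 **KCW-Λ** `KineticClampedWindowLDLambda`: along a classical hs-Euler solution in a packing band, the log-moment-generating function of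
  the window time-average of the CLAMPED current along `Λ` restarted from the explicit local Gibbs reference `ψ_a` with fresh noise, at
  rate `γ/h` with `γ ≤ c₀/V`, is `≤ γ ϑ (N+1)` for windows `h ∈ [h₀, 2h₀] ⊆ (0, 2w₀(ϑ)]`, eventually in `N` — the Lambertian twin of the
  board's `KineticCurrentsWindowLDUniform` under LOCAL Gibbs start (research; the rate cap `c₀/V` is the static Gaussian saddle of the cubic
  heat current, the `ϑ`-smallness is drift `O(h)` + decorrelation `O(γ τ_free/h)`);
* §3 **TL1G-Λ** `GaussianVelocityTailsLambda`: Gaussian `L¹` tails of the peculiar velocities along `Λ` from local Gibbs data, uniformly on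
  `[0,t]` and eventually in `N` (research; the `HighMomentumCutoff` input in the weakest form the clamp remainder needs; NOT a consequence
  of relative entropy `O(N)` alone, and not reachable by the Povzner ladder at hydrodynamic collision rates, `Lines/Sketch.md` §2/§c6.3).

Lead prover-line-stmt-AtomisticToContinuum-11854-c7-0, 2026-08-17.  [cite: Yau1991, §2] [cite: OllaVaradhanYau1993, §3–§4]
-/

noncomputable section

namespace Summit.AtomisticToContinuum.HydrodynamicLimit.Theorems.LambertianContactSwapLambertianEulerKineticInputs

open scoped BigOperators Topology ENNReal InnerProductSpace
open MeasureTheory ProbabilityTheory Filter Set InformationTheory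
open Literature.MathematicalPhysics.KineticTheory
open Literature.Analysis.FluidPDE Literature.Analysis.FluidPDE.Alexander
open Summit.AtomisticToContinuum.HydrodynamicLimit.Theorems.LambertianContactSwapLambertianEulerHearts
open Summit.AtomisticToContinuum.HydrodynamicLimit.Theorems.LambertianContactSwapLambertianEulerHeartsLog

/-! ## §1 The pointwise fast kinetic current and its velocity clamp -/

/-- The **pointwise fast kinetic current** `Y⊥_r(x, v) = θ⁻¹ Σ_{jk} (c_j c_k − δ_{jk}|c|²/3) ∂_k u_j + (|c|² − 5θ)(c·∇θ)/(2θ²)`,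
`c = v − u_r(x)` (traceless peculiar stress against `∇u/θ` + kinetic heat current against `∇θ/(2θ²)`): the integrand of the line's
windowed functional `Yint` (`Yint_eq`). -/
def Ykin (θ : ℝ → T3 → ℝ) (u : ℝ → T3 → V3) (r : ℝ) (y : T3 × V3) : ℝ :=
  (θ r y.1)⁻¹ * ∑ j : Fin 3, ∑ k : Fin 3, ((y.2 - u r y.1) j * (y.2 - u r y.1) k -
      (if j = k then ‖y.2 - u r y.1‖ ^ 2 / 3 else 0)) *
        Literature.Analysis.FunctionSpaces.Torus.partialDeriv k (fun y' => u r y' j) y.1 +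
    (‖y.2 - u r y.1‖ ^ 2 - 5 * θ r y.1) *
      (∑ k : Fin 3, (y.2 - u r y.1) k * Literature.Analysis.FunctionSpaces.Torus.partialDeriv k (θ r) y.1) /
        (2 * (θ r y.1) ^ 2)

/-- The line's windowed kinetic functional IS `E_λ[∫_s^{s′} Σ_i Ykin_r((Λ_r)_i) dr]` (definitional). [folklore] -/
theorem Yint_eq (σ : ℝ) (a₀ θ₀ : T3 → ℝ) (u₀ : T3 → V3) (θ : ℝ → T3 → ℝ) (u : ℝ → T3 → V3)
    (N : ℕ) (Φ : HardSphereFlow (Torus.geometry (Fin 3)) (hsDiameter σ N) (N + 1)) (s s' : ℝ) :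
    Yint σ a₀ θ₀ u₀ θ u N Φ s s' =
      ∫ p, (∫ r in s..s', ∑ i : Fin (N + 1), Ykin θ u r (lambertFlow (Torus.geometry (Fin 3)) (hsDiameter σ N) p.2 p.1 r i))
        ∂((localGibbsLaw σ a₀ u₀ θ₀ N Φ).prod (lambertNoise (Fin 3))) :=
  rfl

/-- The **velocity-clamped current** `Ykin · 1{|v − u_r(x)| ≤ V}` (bounded on bounded profiles: the only form to which the entropy
inequality applies under a Gaussian reference, the heat current being cubic). -/
def YkinClamp (V : ℝ) (θ : ℝ → T3 → ℝ) (u : ℝ → T3 → V3) (r : ℝ) (y : T3 × V3) : ℝ :=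
  if ‖y.2 - u r y.1‖ ≤ V then Ykin θ u r y else 0

/-! ## §2 KCW-Λ — clamped kinetic window large deviations under local-Gibbs restart -/

/-- **KCW-Λ — `KineticClampedWindowLDLambda`** (research input of the kinetic log-heart).  For every insertion factor `(r, Rf)` there is a
band `ηk > 0` and `σ₀ > 0` such that for `0 < σ < σ₀`, every classical hs-Euler solution `(ρ,u,θ)` on `[0,T)` with packing `< ηk`, every
flow family `Φ` (phase spaces) and `t ∈ (0,T)`: there is a rate scale `c₀ > 0` such that for every clamp level `V ≥ 1`, every rate
`0 < γ ≤ c₀/V` and every `ϑ > 0` there is `w₀ > 0` such that for every `0 < h₀ ≤ w₀`, eventually in `N`, for all windows `[a, a+h] ⊆ [0,t]`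
with `h₀ ≤ h ≤ 2h₀`:
`log ∫ exp(−(γ/h) ∫_0^h Σ_i YkinClamp V θ u (a+r′) ((Λ_{r′} q)_i) dr′) d(ψ_a ⊗ γ^ℕ)(q) ≤ γ ϑ (N+1)`,
`ψ_a = localGibbsLaw σ (ρ_a·Rf(σ³ρ_a)) u_a θ_a` — the exponential moment, at a rate fixed per clamp level, of the window time-average of
the clamped fast kinetic current along `Λ` RESTARTED FROM THE REFERENCE with fresh noise is sub-extensive.  Heuristics: the
local-Maxwellian mean of `Ykin` is second order in the parameter deviations (landed STATICS p136127) so the drift inside the window costs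
`O(h)`; decorrelation of the peculiar-velocity quadratic form by the Lambertian contacts (conditional contraction `1/4`, resp. `1/16`, of the
pair traceless stress per redraw) gives the fluctuation term `O(γ τ_free/h) → 0`; the cap `γ ≤ c₀/V` is the static Gaussian saddle of the
clamped cubic heat current.  OPEN — a research statement of this line, not a published fact. -/
def KineticClampedWindowLDLambda : Prop :=
  ∀ (r : ℝ) (Rf : ℝ → ℝ), 0 < r →
      (∀ x ∈ Set.Ioo (-r) r, 0 < Rf x ∧ Rf x * (∑' j : ℕ, bE j / (j.factorial : ℝ) * (x * Rf x) ^ j) = 1) →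
      (∀ x ∈ Set.Icc 0 r, 1 ≤ Rf x ∧ Rf x ≤ 2) → ContinuousOn Rf (Set.Icc 0 r) →
      (∀ x ∈ Set.Ioo (-r) r, ∀ R ∈ Set.Icc (1 / 2 : ℝ) 2,
        R * (∑' j : ℕ, bE j / (j.factorial : ℝ) * (x * R) ^ j) = 1 → R = Rf x) →
    ∃ ηk : ℝ, 0 < ηk ∧ ∃ σ₀ : ℝ, 0 < σ₀ ∧ ∀ σ : ℝ, 0 < σ → σ < σ₀ →
      ∀ (T : ℝ) (ρ θ : ℝ → T3 → ℝ) (u : ℝ → T3 → V3), IsHardSphereEulerSolution σ T ρ u θ →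
        (∀ t ∈ Set.Ico 0 T, ∀ x, ρ t x * σ ^ 3 < ηk) →
        ∀ Φ : (N : ℕ) → HardSphereFlow (Torus.geometry (Fin 3)) (hsDiameter σ N) (N + 1),
          ∀ t ∈ Set.Ioo 0 T, ∃ c₀ : ℝ, 0 < c₀ ∧ ∀ V : ℝ, 1 ≤ V → ∀ γ : ℝ, 0 < γ → γ ≤ c₀ / V →
            ∀ ϑ : ℝ, 0 < ϑ → ∃ w₀ : ℝ, 0 < w₀ ∧ ∀ h₀ : ℝ, 0 < h₀ → h₀ ≤ w₀ → ∃ N₀ : ℕ, ∀ N : ℕ, N₀ ≤ N →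
              ∀ (a h : ℝ), 0 ≤ a → h₀ ≤ h → h ≤ 2 * h₀ → a + h ≤ t →
                Real.log (∫ q, Real.exp (-((γ / h) * ∫ r' in (0 : ℝ)..h, ∑ i : Fin (N + 1),
                    YkinClamp V θ u (a + r') (lambertFlow (Torus.geometry (Fin 3)) (hsDiameter σ N) q.2 q.1 r' i)))
                  ∂((localGibbsLaw σ (fun x => ρ a x * Rf (σ ^ 3 * ρ a x)) (u a) (θ a) N (Φ N)).prod
                    (lambertNoise (Fin 3)))) ≤ γ * ϑ * ((N : ℝ) + 1)

/-! ## §3 TL1G-Λ — Gaussian velocity tails along `Λ` -/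

/-- **TL1G-Λ — `GaussianVelocityTailsLambda`** (research input of the kinetic log-heart).  There is a band `ηv > 0` such that for
continuous positive data profiles there is `σ₀ > 0` such that for `0 < σ < σ₀`, every classical hs-Euler solution with packing `< ηv`,
every flow family tied at `t = 0` and `t ∈ (0,T)`: there are `A, a > 0` such that for every `V ≥ 1`, eventually in `N`, for all
`r′ ∈ [0,t]`: `E_{λ_N ⊗ γ^ℕ}[Σ_i (1 + |v_i(r′)|)³ · 1{|v_i(r′) − u_{r′}(x_i(r′))| > V}] ≤ A e^{−aV²} (N+1)` along `Λ` — Gaussian tails, in `L¹`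
with the cubic weight the clamp remainder of the kinetic current carries, uniformly on `[0,t]`.  Expected TRUE (Maxwellian local
equilibrium), but dynamical: not implied by relative entropy `O(N)` (a coherent block of `K` particles at speed `(N/K)^{1/2}`) and not reachable
by moment ladders at `≍ N^{1/3}` collisions per particle per unit time.  OPEN — a research statement of this line, not a published fact. -/
def GaussianVelocityTailsLambda : Prop :=
  ∃ ηv : ℝ, 0 < ηv ∧ ∀ (a₀ θ₀ : T3 → ℝ) (u₀ : T3 → V3), Continuous a₀ → Continuous θ₀ → Continuous u₀ →
    (∀ x, 0 < a₀ x) → (∀ x, 0 < θ₀ x) →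
    ∃ σ₀ : ℝ, 0 < σ₀ ∧ ∀ σ : ℝ, 0 < σ → σ < σ₀ →
      ∀ (T : ℝ) (ρ θ : ℝ → T3 → ℝ) (u : ℝ → T3 → V3), IsHardSphereEulerSolution σ T ρ u θ →
        (∀ t ∈ Set.Ico 0 T, ∀ x, ρ t x * σ ^ 3 < ηv) →
        ∀ Φ : (N : ℕ) → HardSphereFlow (Torus.geometry (Fin 3)) (hsDiameter σ N) (N + 1),
          TendstoHydroFieldsAt (fun N => localGibbsLaw σ a₀ u₀ θ₀ N (Φ N)) Φ ρ u θ 0 →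
          ∀ t ∈ Set.Ioo 0 T, ∃ A a : ℝ, 0 < A ∧ 0 < a ∧ ∀ V : ℝ, 1 ≤ V → ∃ N₀ : ℕ, ∀ N : ℕ, N₀ ≤ N →
            ∀ r' ∈ Set.Icc 0 t,
              ∫ p, (∑ i : Fin (N + 1),
                  if V < ‖(lambertFlow (Torus.geometry (Fin 3)) (hsDiameter σ N) p.2 p.1 r' i).2 -
                      u r' (lambertFlow (Torus.geometry (Fin 3)) (hsDiameter σ N) p.2 p.1 r' i).1‖ then
                    (1 + ‖(lambertFlow (Torus.geometry (Fin 3)) (hsDiameter σ N) p.2 p.1 r' i).2‖) ^ 3 else 0)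
                ∂((localGibbsLaw σ a₀ u₀ θ₀ N (Φ N)).prod (lambertNoise (Fin 3))) ≤
              A * Real.exp (-(a * V ^ 2)) * ((N : ℝ) + 1)

/-! ## §4 Elementary facts about the clamp (registered sub-goal `abs_YkinClamp_le`) -/

/-- The clamped current vanishes off the clamp and equals the current on it; in particular
`|Ykin − YkinClamp V| = |Ykin| · 1{V < |v − u|}` pointwise. [folklore] -/
theorem abs_Ykin_sub_YkinClamp (V : ℝ) (θ : ℝ → T3 → ℝ) (u : ℝ → T3 → V3) (r : ℝ) (y : T3 × V3) :
    |Ykin θ u r y - YkinClamp V θ u r y| = if V < ‖y.2 - u r y.1‖ then |Ykin θ u r y| else 0 := by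
  unfold YkinClamp
  by_cases h : ‖y.2 - u r y.1‖ ≤ V
  · simp [h, not_lt.2 h]
  · simp [h, not_le.1 h]

/-- A clamped current bounded through a cubic bound of the current: if `|Ykin_r(x,v)| ≤ C (1 + |v|)³` and `|u_r(x)| ≤ W`, then
`|YkinClamp V| ≤ C (1 + V + W)³` (`|v| ≤ |v − u| + |u|`). [folklore] -/
theorem abs_YkinClamp_le : ∀ {V C W : ℝ} {θ : ℝ → T3 → ℝ} {u : ℝ → T3 → V3} {r : ℝ} {y : T3 × V3}, 0 ≤ V → 0 ≤ C →
    |Ykin θ u r y| ≤ C * (1 + ‖y.2‖) ^ 3 → ‖u r y.1‖ ≤ W → |YkinClamp V θ u r y| ≤ C * (1 + V + W) ^ 3 := by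
  intro V C W θ u r y hV hC hY hW
  unfold YkinClamp
  split_ifs with h
  · have hv : ‖y.2‖ ≤ V + W := by
      have := norm_le_norm_sub_add y.2 (u r y.1)
      linarith
    calc |Ykin θ u r y| ≤ C * (1 + ‖y.2‖) ^ 3 := hY
      _ ≤ C * (1 + V + W) ^ 3 :=
          mul_le_mul_of_nonneg_left (pow_le_pow_left₀ (by positivity) (by linarith) 3) hC
  · have : 0 ≤ W := (norm_nonneg _).trans hW
    rw [abs_zero]; positivity

end Summit.AtomisticToContinuum.HydrodynamicLimit.Theorems.LambertianContactSwapLambertianEulerKineticInputs
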